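import Summits.QuantumFields.YangMills.Theorems.LangevinControlUVOSLegsAtWeakCouplingCStubRopeAsymptotics
import Summits.QuantumFields.YangMills.Theorems.LangevinControlUVOSLegsAtWeakCouplingCStubRopeHermitian
import HarnessLib

/-!
# Stub `stub_rope` of line `Sketch` (crux `OSLegsAtWeakCouplingC`, stmt-QuantumFields-16207) — helper VII:
# the growth demand and the bookkeeping of the rope

Helper file for stub `stub_rope` (DefsR3 §4.4).  Everything the final assembly of the rope needs that does not touch
the lattice measure:
* §1 the connected OS form `conn` (DefsR3 §4.3) at arity `0` vanishes when `S₁ 0 = ev`, and for a positive-time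
  off-diagonal `F` and a family with `RPPos`, `S₁ 0 = ev` and translation invariance on `⁰𝒮`,
  `conn S₁ F (T_v F) = S₁(ΘF* ⊗ T_v F) − conj(S₁ F) · S₁ F` (hermiticity `apply_eq_conj_osAdjoint_of_rpPos`),
  which is the limit produced by the lattice machinery; `T_{0} F = F`;
* §2 lattice support: a test function supported in `closedBall 0 ρ ∩ {∀ l, x_l⁰ > 0}` has, at spacing `s`, lattice
  values `F(s y) ≠ 0` only for sites `y_l ∈ box (⌈ρ/s⌉₊ + 1)` with `1 ≤ y_l⁰ ≤ ⌈ρ/s⌉₊`, and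
  `Σ_q Σ_{y ∈ boxⁿ} ‖F(s y)‖ ≤ #strings · ‖F‖_∞`;
* §3 `exists_ropeGrowth` (registered): given the unit map `a` and the anchor constants `D n R ≥ 1` (monotone in `R`)
  there is a growth demand `growth β k` on the torus sides such that along every scheme with `a_k = a(β_k)`,
  `growth (β_k) k ≤ L_k`, `a_k → 0`, for every arity `n`, support radius `ρ ≥ 0`, separation `t > 0`, the choices
  `m_k = ⌊t/a_k⌋`, `w_k = ⌈ρ/a_k⌉ + 1`, `J_k = log₂ ((L_k − 2w_k)/m_k)` satisfy: eventually `1 ≤ m_k ≤ 2^{J_k} m_k`,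
  `2^{J_k} m_k + 2 w_k ≤ L_k`; `a_k m_k → t`; `2^{J_k} → ∞`; and `log ((1 + S_k)² D n w_k) / 2^{J_k} → 0` for every
  `0 ≤ S_k ≤ #strings(n, w_k) · M` — the real-variable lemmas of helper VI (`hankel_steps`, `tendsto_steps_atTop`,
  `tendsto_log_div_steps`) fed with `growth β k = ⌈(k+1)(k+1+Λ β k)/a β⌉`,
  `Λ β k = log Σ_{n ≤ k} (1 + #strings(n, R'))² D n R'`, `R' = ⌈k / a β⌉ + 1`.
Refs: OsterwalderSeiler1978 §2; GlimmJaffe1987 §19.7 (the choice of volumes); FrohlichIsraelLiebSimon1978 §2.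
-/

set_option autoImplicit false

noncomputable section

open scoped SchwartzMap BigOperators ComplexConjugate
open Filter Topology
open Literature.MathematicalPhysics.QuantumLattice Literature.MathematicalPhysics.AQFT
open Literature.Probability.LatticeModels (box Site mem_box box_mono)
open Summit.QuantumFields.YangMills.Cruxes.OSLegsFromFemtoAndGap.DlrCollarTransfer (conn RPPos)
open Summit.QuantumFields.YangMills.Theorems.OSLegsFromFemtoAndGap

namespace Summit.QuantumFields.YangMills.Theorems.OSLegsAtWeakCouplingC

namespace RopeGrowth

/-! ## §1 The connected OS form: arity zero, hermiticity, zero translation -/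

/-- At arity `0` the connected OS form vanishes when `S₁ 0 = ev`. -/
theorem conn_arity_zero (S₁ : SchwingerFamily (EuclideanSpace ℝ (Fin 4))) (h9 : ∀ F : 𝓢((Fin 0 → (EuclideanSpace ℝ (Fin 4))), ℂ), S₁ 0 F = F default)
    (F G : 𝓢((Fin 0 → (EuclideanSpace ℝ (Fin 4))), ℂ)) : conn S₁ F G = 0 := by
  unfold conn
  have h1 : S₁ (0 + 0) ((osAdjoint F).appendTensor G) = (osAdjoint F) default * G default := by
    refine (h9 ((osAdjoint F).appendTensor G)).trans ?_
    rw [SchwartzMap.appendTensor_apply]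
    exact congrArg₂ (· * ·) (congrArg _ (Subsingleton.elim _ _)) (congrArg _ (Subsingleton.elim _ _))
  rw [h1, h9, h9, sub_self]

/-- **The connected OS form against a translate, through hermiticity**: for positive-time off-diagonal `F` and a
family with `S₁ 0 = ev`, translation invariance on `⁰𝒮` and `RPPos`,
`conn S₁ F (T_v F) = S₁(ΘF* ⊗ T_v F) − conj(S₁ F) · S₁ F`. -/
theorem conn_translate_of_rpPos (S₁ : SchwingerFamily (EuclideanSpace ℝ (Fin 4))) (h9 : ∀ F : 𝓢((Fin 0 → (EuclideanSpace ℝ (Fin 4))), ℂ), S₁ 0 F = F default)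
    (h8 : ∀ (n : ℕ) (t : (EuclideanSpace ℝ (Fin 4))) (F : 𝓢((Fin n → (EuclideanSpace ℝ (Fin 4))), ℂ)), IsOffDiagonal F → S₁ n (translateMulti t F) = S₁ n F)
    (hRP : RPPos S₁) {n : ℕ} {F : 𝓢((Fin n → (EuclideanSpace ℝ (Fin 4))), ℂ)} (hFp : IsPositiveTimeMulti F) (hFo : IsOffDiagonal F)
    (v : (EuclideanSpace ℝ (Fin 4))) :
    conn S₁ F (translateMulti v F) =
      S₁ (n + n) ((osAdjoint F).appendTensor (translateMulti v F)) - conj (S₁ n F) * S₁ n F := by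
  have herm : conj (S₁ n F) = S₁ n (osAdjoint F) := by
    rw [apply_eq_conj_osAdjoint_of_rpPos S₁ h9 hRP hFp hFo, Complex.conj_conj]
  unfold conn
  rw [h8 n v F hFo, herm]

/-- `T_{0·e₀} F = F`. -/
theorem translateMulti_single_zero {n : ℕ} (F : 𝓢((Fin n → (EuclideanSpace ℝ (Fin 4))), ℂ)) :
    translateMulti (EuclideanSpace.single (0 : Fin 4) (0 : ℝ)) F = F := by
  have hs : EuclideanSpace.single (0 : Fin 4) (0 : ℝ) = 0 := by
    ext j; simp
  rw [hs]
  ext x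
  simp

/-! ## §2 Lattice support of a compactly supported positive-time test function -/

/-- **Lattice support**: if `tsupport F ⊆ closedBall 0 ρ ∩ {∀ l, 0 < x_l⁰}` and `F(s y) ≠ 0` (`s > 0`), every site has
`y_l ∈ box (⌈ρ/s⌉₊ + 1)`, `1 ≤ y_l⁰` and `y_l⁰ + 1 ≤ ⌈ρ/s⌉₊ + 1`. -/
theorem lattice_support {n : ℕ} {F : 𝓢((Fin n → (EuclideanSpace ℝ (Fin 4))), ℂ)} (hFp : IsPositiveTimeMulti F) {ρ : ℝ}
    (hρ : tsupport (F : (Fin n → (EuclideanSpace ℝ (Fin 4))) → ℂ) ⊆ Metric.closedBall 0 ρ) {s : ℝ} (hs : 0 < s) {y : Fin n → Site 4}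
    (hy : F (fun l => s • siteToE (y l)) ≠ 0) (l : Fin n) :
    y l ∈ box 4 (⌈ρ / s⌉₊ + 1) ∧ 1 ≤ y l 0 ∧ y l 0 + 1 ≤ ((⌈ρ / s⌉₊ + 1 : ℕ) : ℤ) := by
  have hmem := subset_tsupport _ hy
  have hnorm : ‖(fun l => s • siteToE (y l))‖ ≤ ρ := mem_closedBall_zero_iff.1 (hρ hmem)
  have hcoord : ∀ i, |s * (y l i : ℝ)| ≤ ρ := fun i => by
    have h1 : ‖(s • siteToE (y l)) i‖ ≤ ‖s • siteToE (y l)‖ := PiLp.norm_apply_le _ i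
    rw [PiLp.smul_apply, siteToE_apply, smul_eq_mul, Real.norm_eq_abs] at h1
    exact h1.trans ((norm_le_pi_norm (fun l => s • siteToE (y l)) l).trans hnorm)
  have hceil : ρ / s ≤ ⌈ρ / s⌉₊ := Nat.le_ceil _
  have habs : ∀ i, |(y l i : ℝ)| ≤ ⌈ρ / s⌉₊ := fun i => by
    have h := hcoord i
    rw [abs_mul, abs_of_pos hs] at h
    exact ((le_div_iff₀' hs).2 h).trans hceil
  have hint : ∀ i, -((⌈ρ / s⌉₊ : ℕ) : ℤ) ≤ y l i ∧ y l i ≤ ⌈ρ / s⌉₊ := fun i => by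
    have h := abs_le.1 (habs i)
    have h1 : (((-((⌈ρ / s⌉₊ : ℕ) : ℤ) : ℤ)) : ℝ) ≤ ((y l i : ℤ) : ℝ) := by push_cast; exact h.1
    have h2 : ((y l i : ℤ) : ℝ) ≤ (((⌈ρ / s⌉₊ : ℕ) : ℤ) : ℝ) := by push_cast; exact h.2
    exact ⟨by exact_mod_cast h1, by exact_mod_cast h2⟩
  have htime : 0 < y l 0 := by
    have h := hFp hmem l
    simp only [PiLp.smul_apply, siteToE_apply, smul_eq_mul] at h
    exact_mod_cast (mul_pos_iff_of_pos_left hs).1 h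
  refine ⟨mem_box.2 fun i => ⟨?_, ?_⟩, by omega, ?_⟩
  · have := (hint i).1; push_cast; omega
  · have := (hint i).2; push_cast; omega
  · have := (hint 0).2; push_cast; omega

/-- **The lattice values are bounded by the number of strings times `‖F‖_∞`.** -/
theorem sum_norm_apply_le {n : ℕ} (F : 𝓢((Fin n → (EuclideanSpace ℝ (Fin 4))), ℂ)) (s : ℝ) (R : ℕ) :
    ∑ _q ∈ Fintype.piFinset (fun _ : Fin n => Finset.univ.filter fun pl : Fin 4 × Fin 4 => pl.1 < pl.2),
        ∑ y ∈ Fintype.piFinset (fun _ : Fin n => box 4 R), ‖F (fun l => s • siteToE (y l))‖ ≤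
      ((Fintype.piFinset fun _ : Fin n => Finset.univ.filter fun pl : Fin 4 × Fin 4 => pl.1 < pl.2).card : ℝ) *
        ((Fintype.piFinset fun _ : Fin n => box 4 R).card : ℝ) * SchwartzMap.seminorm ℂ 0 0 F := by
  have hF : ∀ x, ‖F x‖ ≤ SchwartzMap.seminorm ℂ 0 0 F := fun x => by
    have := SchwartzMap.le_seminorm ℂ 0 0 F x; rwa [pow_zero, one_mul, norm_iteratedFDeriv_zero] at this
  calc _ ≤ ∑ _q ∈ Fintype.piFinset (fun _ : Fin n => Finset.univ.filter fun pl : Fin 4 × Fin 4 => pl.1 < pl.2),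
        ∑ _y ∈ Fintype.piFinset (fun _ : Fin n => box 4 R), SchwartzMap.seminorm ℂ 0 0 F :=
        Finset.sum_le_sum fun q _ => Finset.sum_le_sum fun y _ => hF _
    _ = _ := by simp only [Finset.sum_const, nsmul_eq_mul]; ring

/-! ## §3 The growth demand -/

/-- `a · ⌊t / a⌋₊ ∈ (t − a, t]` for `a > 0`, `t ≥ 0`. -/
theorem mul_floor_div_bounds {a t : ℝ} (ha : 0 < a) (ht : 0 ≤ t) :
    t - a < a * ⌊t / a⌋₊ ∧ a * ⌊t / a⌋₊ ≤ t := by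
  constructor
  · have h := Nat.lt_floor_add_one (t / a)
    have : a * (t / a) < a * (⌊t / a⌋₊ + 1) := mul_lt_mul_of_pos_left h ha
    rw [mul_div_cancel₀ _ ha.ne', mul_add, mul_one] at this
    linarith
  · calc a * ⌊t / a⌋₊ ≤ a * (t / a) := mul_le_mul_of_nonneg_left (Nat.floor_le (div_nonneg ht ha.le)) ha.le
      _ = t := mul_div_cancel₀ _ ha.ne'

/-- `a · (⌈ρ / a⌉₊ + 1) ≤ ρ + 2a` for `a > 0`, `ρ ≥ 0`. -/
theorem mul_ceil_div_succ_le {a ρ : ℝ} (ha : 0 < a) (hρ : 0 ≤ ρ) :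
    a * (((⌈ρ / a⌉₊ + 1 : ℕ)) : ℝ) ≤ ρ + 2 * a := by
  have h := Nat.ceil_lt_add_one (div_nonneg hρ ha.le)
  have : a * (⌈ρ / a⌉₊ : ℝ) ≤ a * (ρ / a + 1) := mul_le_mul_of_nonneg_left h.le ha.le
  rw [mul_add, mul_div_cancel₀ _ ha.ne', mul_one] at this
  push_cast
  linarith

/-- **Eventual bookkeeping of the dyadic steps**: with `m_k = ⌊t/a_k⌋`, `w_k = ⌈ρ/a_k⌉ + 1`,
`J_k = log₂ ((L_k − 2w_k)/m_k)` and a torus side `a_k L_k ≥ (k+1)(k+1+Λ_k)`, eventually `1 ≤ m_k ≤ 2^{J_k} m_k`,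
`2^{J_k} m_k + 2w_k ≤ L_k`, `a_k L_k − 2 a_k w_k < 2 · 2^{J_k} · a_k m_k` and `2 a_k w_k ≤ 2ρ + 4`. -/
theorem eventually_steps {ak Λk : ℕ → ℝ} {Lk m w J : ℕ → ℕ} {t ρ : ℝ} (hak0 : ∀ k, 0 < ak k)
    (ha0 : Tendsto ak atTop (𝓝 0)) (ht : 0 < t) (hρ : 0 ≤ ρ) (hΛ0 : ∀ k, 0 ≤ Λk k)
    (hP : ∀ k : ℕ, ((k : ℝ) + 1) * ((k : ℝ) + 1 + Λk k) ≤ ak k * Lk k) (hm : ∀ k, m k = ⌊t / ak k⌋₊)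
    (hw : ∀ k, w k = ⌈ρ / ak k⌉₊ + 1) (hJ : ∀ k, J k = Nat.log 2 ((Lk k - 2 * w k) / m k)) :
    ∀ᶠ k in atTop, 1 ≤ m k ∧ m k ≤ 2 ^ J k * m k ∧ 2 ^ J k * m k + 2 * w k ≤ Lk k ∧
      ak k * Lk k - ak k * (2 * w k) < 2 * ((2 ^ J k : ℕ) : ℝ) * (ak k * m k) ∧
      ak k * (2 * w k) ≤ (2 * ρ + 3) + 1 := by
  have ha1 : ∀ᶠ k in atTop, ak k ≤ 1 := ha0.eventually (eventually_le_nhds one_pos)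
  have hat : ∀ᶠ k in atTop, ak k ≤ t := ha0.eventually (eventually_le_nhds ht)
  have hk1 : ∀ᶠ k : ℕ in atTop, t + 2 * ρ + 5 ≤ (k : ℝ) + 1 :=
    (tendsto_atTop_add_const_right _ 1 tendsto_natCast_atTop_atTop).eventually_ge_atTop _
  filter_upwards [ha1, hat, hk1] with k ha1 hat hk1
  have hm1 : 1 ≤ m k := by
    rw [hm k]; exact Nat.le_floor (by rw [Nat.cast_one, le_div_iff₀ (hak0 k), one_mul]; exact hat)
  have h1 : ak k * m k ≤ t := by rw [hm k]; exact (mul_floor_div_bounds (hak0 k) ht.le).2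
  have h2 : ak k * w k ≤ ρ + 2 * ak k := by rw [hw k]; exact mul_ceil_div_succ_le (hak0 k) hρ
  have hmw : m k + 2 * w k ≤ Lk k := by
    have h3 := hP k
    have h4 : (k : ℝ) + 1 ≤ ((k : ℝ) + 1) * ((k : ℝ) + 1 + Λk k) :=
      le_mul_of_one_le_right (by positivity) (by linarith [hΛ0 k])
    have e : ak k * ((m k : ℝ) + 2 * w k) = ak k * m k + 2 * (ak k * w k) := by ring
    have h6 : ak k * ((m k : ℝ) + 2 * w k) < ak k * Lk k := by rw [e]; linarith
    have h7 : ((m k : ℝ) + 2 * w k) < Lk k := lt_of_mul_lt_mul_left h6 (hak0 k).le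
    exact_mod_cast h7.le
  have hst := hankel_steps hm1 hmw
  rw [← hJ k] at hst
  have hle : 2 * w k ≤ Lk k := le_trans (Nat.le_add_left _ _) hst.1
  have h4' : ((Lk k : ℝ) - 2 * w k) < 2 * 2 ^ J k * m k := by
    have h := hst.2
    rw [← Nat.cast_lt (α := ℝ), Nat.cast_sub hle] at h
    push_cast at h
    exact h
  have h5 := mul_lt_mul_of_pos_left h4' (hak0 k)
  have e1 : ak k * Lk k - ak k * (2 * (w k : ℝ)) = ak k * ((Lk k : ℝ) - 2 * w k) := by ring
  have e2 : 2 * (2 : ℝ) ^ J k * (ak k * m k) = ak k * (2 * 2 ^ J k * m k) := by ring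
  have e3 : ak k * (2 * (w k : ℝ)) = 2 * (ak k * w k) := by ring
  refine ⟨hm1, Nat.le_mul_of_pos_left _ (pow_pos two_pos _), hst.1, ?_, ?_⟩
  · push_cast; rw [e1, e2]; exact h5
  · rw [e3]; linarith

/-- **The loss bookkeeping**: `log ((1+S)² D) ≤ log (1+M)² + log Z` when `0 ≤ S ≤ c M`, `1 ≤ D`, `(1+c)² D ≤ Z`. -/
theorem log_loss_le {M c S D Z : ℝ} (hM : 0 ≤ M) (hc : 0 ≤ c) (hS0 : 0 ≤ S) (hS : S ≤ c * M) (hD : 1 ≤ D)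
    (hZ : (1 + c) ^ 2 * D ≤ Z) :
    Real.log ((1 + S) ^ 2 * D) ≤ Real.log ((1 + M) ^ 2) + 1 * Real.log Z := by
  have hD0 : 0 ≤ D := zero_le_one.trans hD
  have hcM : 0 ≤ c * M := mul_nonneg hc hM
  have hS1 : 1 + S ≤ (1 + M) * (1 + c) := by
    have e : (1 + M) * (1 + c) = 1 + c * M + (M + c) := by ring
    rw [e]; linarith
  have h1 : (1 + S) ^ 2 * D ≤ (1 + M) ^ 2 * ((1 + c) ^ 2 * D) := by
    calc (1 + S) ^ 2 * D ≤ ((1 + M) * (1 + c)) ^ 2 * D := by gcongr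
      _ = (1 + M) ^ 2 * ((1 + c) ^ 2 * D) := by ring
  have hpos : 0 < (1 + S) ^ 2 * D :=
    zero_lt_one.trans_le (one_le_mul_of_one_le_of_one_le (one_le_pow₀ (by linarith)) hD)
  have hZ1 : 1 ≤ (1 + c) ^ 2 * D := one_le_mul_of_one_le_of_one_le (one_le_pow₀ (by linarith)) hD
  calc Real.log ((1 + S) ^ 2 * D) ≤ Real.log ((1 + M) ^ 2 * ((1 + c) ^ 2 * D)) := Real.log_le_log hpos h1
    _ = Real.log ((1 + M) ^ 2) + Real.log ((1 + c) ^ 2 * D) :=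
        Real.log_mul (by positivity) (zero_lt_one.trans_le hZ1).ne'
    _ ≤ Real.log ((1 + M) ^ 2) + 1 * Real.log Z := by
        have := Real.log_le_log (zero_lt_one.trans_le hZ1) hZ
        linarith

/-- **The growth demand of the rope** (scheme form): see the file docstring, §3. -/
theorem exists_ropeGrowth' {a : ℝ → ℝ} (ha : ∀ β, 0 < a β) (D : ℕ → ℕ → ℝ) (hDm : ∀ n, Monotone (D n))
    (hD1 : ∀ n R, 1 ≤ D n R) :
    ∃ growth : ℝ → ℕ → ℕ, ∀ (βk ak : ℕ → ℝ) (Lk : ℕ → ℕ), (∀ k, ak k = a (βk k)) →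
      (∀ k, growth (βk k) k ≤ Lk k) → Tendsto ak atTop (𝓝 0) →
      ∀ (n : ℕ) (ρ : ℝ), 0 ≤ ρ → ∀ (t : ℝ), 0 < t → ∀ (m w J : ℕ → ℕ), (∀ k, m k = ⌊t / ak k⌋₊) →
        (∀ k, w k = ⌈ρ / ak k⌉₊ + 1) → (∀ k, J k = Nat.log 2 ((Lk k - 2 * w k) / m k)) →
        (∀ᶠ k in atTop, 1 ≤ m k ∧ m k ≤ 2 ^ J k * m k ∧ 2 ^ J k * m k + 2 * w k ≤ Lk k) ∧
        Tendsto (fun k => ak k * m k) atTop (𝓝 t) ∧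
        Tendsto (fun k => 2 ^ J k) atTop atTop ∧
        ∀ (M : ℝ), 0 ≤ M → ∀ (S : ℕ → ℝ), (∀ k, 0 ≤ S k) →
          (∀ k, S k ≤ ((Fintype.piFinset fun _ : Fin n => Finset.univ.filter fun pl : Fin 4 × Fin 4 => pl.1 < pl.2).card : ℝ) *
            ((Fintype.piFinset fun _ : Fin n => box 4 (w k)).card : ℝ) * M) →
          Tendsto (fun k => Real.log ((1 + S k) ^ 2 * D n (w k)) / ((2 ^ J k : ℕ) : ℝ)) atTop (𝓝 0) := by
  -- the number of lattice strings with sites in `box R`, and the majorant `Φ`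
  obtain ⟨cnt, hcnt0, hcntm, hcnt⟩ : ∃ cnt : ℕ → ℕ → ℝ, (∀ n R, 0 ≤ cnt n R) ∧ (∀ n, Monotone (cnt n)) ∧
      ∀ n R, cnt n R =
        ((Fintype.piFinset fun _ : Fin n => Finset.univ.filter fun pl : Fin 4 × Fin 4 => pl.1 < pl.2).card : ℝ) *
          ((Fintype.piFinset fun _ : Fin n => box 4 R).card : ℝ) := by
    refine ⟨fun n R => ((Fintype.piFinset fun _ : Fin n =>
        Finset.univ.filter fun pl : Fin 4 × Fin 4 => pl.1 < pl.2).card : ℝ) *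
      ((Fintype.piFinset fun _ : Fin n => box 4 R).card : ℝ), fun n R => ?_, fun n R R' h => ?_, fun n R => rfl⟩
    · exact mul_nonneg (Nat.cast_nonneg _) (Nat.cast_nonneg _)
    · have hc : (Fintype.piFinset fun _ : Fin n => box 4 R).card ≤
          (Fintype.piFinset fun _ : Fin n => box 4 R').card :=
        Finset.card_le_card (Fintype.piFinset_subset _ _ fun _ => box_mono 4 h)
      exact mul_le_mul_of_nonneg_left (by exact_mod_cast hc) (Nat.cast_nonneg _)
  obtain ⟨Φ, hΦ1, hΦm, hΦ⟩ : ∃ Φ : ℕ → ℕ → ℝ, (∀ n R, 1 ≤ Φ n R) ∧ (∀ n, Monotone (Φ n)) ∧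
      ∀ n R, Φ n R = (1 + cnt n R) ^ 2 * D n R := by
    refine ⟨fun n R => (1 + cnt n R) ^ 2 * D n R, fun n R => ?_, fun n R R' h => ?_, fun n R => rfl⟩
    · exact one_le_mul_of_one_le_of_one_le (one_le_pow₀ (by linarith [hcnt0 n R])) (hD1 n R)
    · have h1 := hcntm n h
      have h3 := hcnt0 n R
      have h4 : 0 ≤ D n R := zero_le_one.trans (hD1 n R)
      exact mul_le_mul (pow_le_pow_left₀ (by linarith) (by linarith) 2) (hDm n h) h4
        (pow_nonneg (by linarith [hcnt0 n R']) 2)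
  let R' : ℝ → ℕ → ℕ := fun β k => ⌈(k : ℝ) / a β⌉₊ + 1
  let Λ : ℝ → ℕ → ℝ := fun β k => Real.log (∑ n ∈ Finset.range (k + 1), Φ n (R' β k))
  have hsum1 : ∀ β k n, n ≤ k → Φ n (R' β k) ≤ ∑ n' ∈ Finset.range (k + 1), Φ n' (R' β k) := fun β k n hn =>
    Finset.single_le_sum (f := fun n' => Φ n' (R' β k)) (fun n' _ => zero_le_one.trans (hΦ1 n' _))
      (Finset.mem_range.2 (Nat.lt_succ_of_le hn))
  have hΛ0 : ∀ β k, 0 ≤ Λ β k := fun β k => Real.log_nonneg ((hΦ1 0 _).trans (hsum1 β k 0 (Nat.zero_le _)))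
  refine ⟨fun β k => ⌈((k : ℝ) + 1) * ((k : ℝ) + 1 + Λ β k) / a β⌉₊, ?_⟩
  intro βk ak Lk hak hg ha0 n ρ hρ t ht m w J hm hw hJ
  have hak0 : ∀ k, 0 < ak k := fun k => by rw [hak]; exact ha _
  have hg' : ∀ k : ℕ, ⌈((k : ℝ) + 1) * ((k : ℝ) + 1 + Λ (βk k) k) / a (βk k)⌉₊ ≤ Lk k := fun k => hg k
  -- physical separation and torus side
  have hmt : Tendsto (fun k => ak k * m k) atTop (𝓝 t) := by
    refine tendsto_of_tendsto_of_tendsto_of_le_of_le (g := fun k => t - ak k) (h := fun _ => t) ?_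
      tendsto_const_nhds (fun k => ?_) (fun k => ?_)
    · simpa using (tendsto_const_nhds (x := t)).sub ha0
    · rw [hm k]; exact (mul_floor_div_bounds (hak0 k) ht.le).1.le
    · rw [hm k]; exact (mul_floor_div_bounds (hak0 k) ht.le).2
  have hP : ∀ k : ℕ, ((k : ℝ) + 1) * ((k : ℝ) + 1 + Λ (βk k) k) ≤ ak k * Lk k := fun k => by
    have h2 : ((k : ℝ) + 1) * ((k : ℝ) + 1 + Λ (βk k) k) / a (βk k) ≤ Lk k :=
      (Nat.le_ceil _).trans (by exact_mod_cast hg' k)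
    rw [div_le_iff₀ (ha _), ← hak k] at h2
    linarith [mul_comm (ak k) (Lk k : ℝ)]
  have hev := eventually_steps hak0 ha0 ht hρ (fun k => hΛ0 (βk k) k) hP hm hw hJ
  have hP' : ∀ᶠ k : ℕ in atTop, ((k : ℝ) + 1) * ((k : ℝ) + 1 + Λ (βk k) k) ≤ ak k * Lk k :=
    Eventually.of_forall hP
  have hQ' : ∀ᶠ k in atTop, ak k * (2 * w k) ≤ (2 * ρ + 3) + 1 := hev.mono fun k hk => hk.2.2.2.2
  have hN' : ∀ᶠ k in atTop, ak k * Lk k - ak k * (2 * w k) < 2 * ((2 ^ J k : ℕ) : ℝ) * (ak k * m k) :=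
    hev.mono fun k hk => hk.2.2.2.1
  refine ⟨hev.mono fun k hk => ⟨hk.1, hk.2.1, hk.2.2.1⟩, hmt,
    tendsto_steps_atTop (fun k => hΛ0 (βk k) k) hP' hQ' hmt ht hN', ?_⟩
  -- the loss exponent
  intro M hM S hS0 hS
  have hC1 : ∀ k, 1 ≤ (1 + S k) ^ 2 * D n (w k) := fun k =>
    one_le_mul_of_one_le_of_one_le (one_le_pow₀ (by linarith [hS0 k])) (hD1 n _)
  have hρk : ∀ᶠ k : ℕ in atTop, ρ ≤ k := tendsto_natCast_atTop_atTop.eventually_ge_atTop ρ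
  have hnk : ∀ᶠ k : ℕ in atTop, n ≤ k := eventually_ge_atTop n
  have hlogC : ∀ᶠ k in atTop, Real.log ((1 + S k) ^ 2 * D n (w k)) ≤
      Real.log ((1 + M) ^ 2) + 1 * Λ (βk k) k := by
    filter_upwards [hρk, hnk] with k hρk hnk
    have hwR : w k ≤ R' (βk k) k := by
      rw [hw k]
      refine Nat.add_le_add_right (Nat.ceil_mono ?_) 1
      rw [← hak k]
      exact div_le_div_of_nonneg_right hρk (hak0 k).le
    refine log_loss_le hM (hcnt0 n (w k)) (hS0 k) (by rw [hcnt]; exact hS k) (hD1 n _) ?_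
    rw [← hΦ]
    exact ((hΦm n) hwR).trans (hsum1 (βk k) k n hnk)
  exact tendsto_log_div_steps' zero_le_one (Real.log_nonneg (one_le_pow₀ (by linarith)))
    (fun k => hΛ0 (βk k) k) hC1 hlogC hP' hQ' hmt ht hN'

end RopeGrowth

/-- **The growth demand of the rope** (registered helper of `stub_rope`): given the unit map `a` and anchor constants
`D n R ≥ 1` monotone in `R`, a growth demand `growth β k` on the torus sides such that along every scheme with
`a_k = a(β_k)`, `growth (β_k) k ≤ L_k`, `a_k → 0`, the dyadic Hankel steps `m_k = ⌊t/a_k⌋`, `w_k = ⌈ρ/a_k⌉ + 1`,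
`J_k = log₂ ((L_k − 2w_k)/m_k)` fit in the torus eventually, `a_k m_k → t`, `2^{J_k} → ∞`, and the loss exponent
`log ((1 + S_k)² D n w_k) / 2^{J_k}` of any prefactor with `S_k ≤ #strings(n, w_k) · M` tends to zero. -/
theorem exists_ropeGrowth : ∀ {a : ℝ → ℝ}, (∀ β, 0 < a β) → ∀ (D : ℕ → ℕ → ℝ), (∀ n, Monotone (D n)) → (∀ n R, 1 ≤ D n R) → ∃ growth : ℝ → ℕ → ℕ, ∀ (βk ak : ℕ → ℝ) (Lk : ℕ → ℕ), (∀ k, ak k = a (βk k)) → (∀ k, growth (βk k) k ≤ Lk k) → Filter.Tendsto ak Filter.atTop (nhds 0) → ∀ (n : ℕ) (ρ : ℝ), 0 ≤ ρ → ∀ (t : ℝ), 0 < t → ∀ (m w J : ℕ → ℕ), (∀ k, m k = ⌊t / ak k⌋₊) → (∀ k, w k = ⌈ρ / ak k⌉₊ + 1) → (∀ k, J k = Nat.log 2 ((Lk k - 2 * w k) / m k)) → (∀ᶠ k in Filter.atTop, 1 ≤ m k ∧ m k ≤ 2 ^ J k * m k ∧ 2 ^ J k * m k + 2 * w k ≤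 Lk k) ∧ Filter.Tendsto (fun k => ak k * m k) Filter.atTop (nhds t) ∧ Filter.Tendsto (fun k => 2 ^ J k) Filter.atTop Filter.atTop ∧ ∀ (M : ℝ), 0 ≤ M → ∀ (S : ℕ → ℝ), (∀ k, 0 ≤ S k) → (∀ k, S k ≤ ((Fintype.piFinset fun _ : Fin n => Finset.univ.filter fun pl : Fin 4 × Fin 4 => pl.1 < pl.2).card : ℝ) * ((Fintype.piFinset fun _ : Fin n => Literature.Probability.LatticeModels.box 4 (w k)).card : ℝ) * M) → Filter.Tendsto (fun k => Real.log ((1 + S k) ^ 2 * D n (w k)) / ((2 ^ J k : ℕ) : ℝ)) Filter.atTop (nhds 0) :=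
  fun ha D hDm hD1 => RopeGrowth.exists_ropeGrowth' ha D hDm hD1


end Summit.QuantumFields.YangMills.Theorems.OSLegsAtWeakCouplingC

end
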